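import Mathlib
import HarnessLib
import Summits.ValiantsHypothesis.ValiantsHypothesis.Theses.MonotoneRestoration
import Literature.Computability.AlgebraicComplexity.ArithCircuit
import Literature.Computability.AlgebraicComplexity.ArithCircuitProofs
import Literature.Computability.AlgebraicComplexity.MonotoneStructure
import Literature.Computability.AlgebraicComplexity.PermanentIrreducible
import Literature.ModelTheory.FiniteModelTheory.CkEquiv
import Summits.ValiantsHypothesis.ValiantsHypothesis.Theorems.MonotoneRestorationMonotoneRestorationQPCosetCount
import Summits.ValiantsHypothesis.ValiantsHypothesis.Theorems.MonotoneRestorationMonotoneRestorationQPSymmetricLB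
import Summits.ValiantsHypothesis.ValiantsHypothesis.Theorems.MonotoneRestorationMonotoneRestorationQPSupportSymmetrisation
import Summits.ValiantsHypothesis.ValiantsHypothesis.Theorems.MonotoneRestorationMonotoneRestorationQPSparseRegime
import Summits.ValiantsHypothesis.ValiantsHypothesis.Theorems.MonotoneRestorationMonotoneRestorationQPBeta
import Literature.Computability.AlgebraicComplexity.SymmetricArithCircuit
import Literature.Computability.AlgebraicComplexity.DawarWilsenach2025Proofs
import Literature.GroupTheory.PermutationGroups.SmallIndexSubgroups
import Summits.ValiantsHypothesis.ValiantsHypothesis.Theorems.MonotoneRestorationQP.Negative.LoadBearing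
import Summits.ValiantsHypothesis.ValiantsHypothesis.Theorems.MonotoneRestorationMonotoneRestorationQPPermSupportCount
import Summits.ValiantsHypothesis.ValiantsHypothesis.Theorems.MonotoneRestorationMonotoneRestorationQPMulGateChildren
import Summits.ValiantsHypothesis.ValiantsHypothesis.Theorems.MonotoneRestorationMonotoneRestorationQPVariants18951

/-! TTRL-lite variant V19872 of stmt-ValiantsHypothesis-15886 -/

-- `ValiantsHypothesis.ValiantsHypothesis`: the D-0017 layout repeats the problem name in the path.
set_option linter.dupNamespace false

namespace Summit.ValiantsHypothesis.ValiantsHypothesis.Theorems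

open Summit.ValiantsHypothesis.ValiantsHypothesis.Theses.MonotoneRestoration
open Literature.Computability.AlgebraicComplexity

/-- **Strict degree drop below a multiplication gate** (TTRL-lite variant V19872 of
`stub_mulGate_children_extend`, stmt-ValiantsHypothesis-15886). Over `ℝ≥0` nothing cancels: if
`P` is a `×` gate with `eval P ≠ 0` whose monomials extend (by a common shift) to monomials of
`f`, and a child `h` has a *non-constant* sibling `h' ≠ h` (`1 ≤ totalDegree (eval h')`), then
`totalDegree (eval h) < totalDegree f`. This is the strictly decreasing quantity along the
`γ` spine. Proof: the two-children degree budget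
`totalDegree (eval h) + totalDegree (eval h') ≤ totalDegree f`
(`stub_mulGate_children_extend_var18951`) and `1 ≤ totalDegree (eval h')`. [folklore] -/
theorem stub_mulGate_children_extend_var19872 :
    ∀ (n : ℕ) (G : Type) (C : LabelledArithCircuit NNReal (Fin n × Fin n) Unit G)
      (f : MvPolynomial (Fin n × Fin n) NNReal) (P : G), C.label P = .mul → C.eval P ≠ 0 →
      (∃ μ : (Fin n × Fin n) →₀ ℕ, ∀ m ∈ (C.eval P).support, m + μ ∈ f.support) →
      ∀ h ∈ C.children P, ∀ h' ∈ C.children P, h ≠ h' → 1 ≤ (C.eval h').totalDegree →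
        (C.eval h).totalDegree < f.totalDegree := by
  intro n G C f P hP hP0 hext h hh h' hh' hne hdeg
  have hsum := stub_mulGate_children_extend_var18951 n G C f P hP hP0 hext h hh h' hh' hne
  omega

end Summit.ValiantsHypothesis.ValiantsHypothesis.Theorems
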